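import Summits.FinalStateConjecture.FinalStateConjecture.Theorems.PhotonSphereChannelsTameEternalLimitDefs
import Summits.FinalStateConjecture.FinalStateConjecture.Theorems.PhotonSphereChannelsTameHullDefs
import Literature.Geometry.Lorentzian.MinkowskiGlobalHyperbolicity
import Literature.Geometry.Lorentzian.CausalCurveLengthBound
import Literature.Geometry.Lorentzian.CauchyDevelopmentGlobalHyperbolicityProofs
import Literature.Geometry.Lorentzian.CausalFutureCompactSet
import Literature.Geometry.Lorentzian.NullRayNonImprisonment
import HarnessLib

/-!
# Crux `ChannelsResolveTameDevelopmentsR` (stmt-FinalStateConjecture-14075), line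
# `trapped-set-observability-analyticity` — S7 sub-goal C6: the time separation from the Cauchy
# hypersurface is bounded on compact sets; the escape-notion bridge is unconditional

The audit of the tame endgame `stub_tameEndgame` (S7, file
`PhotonSphereChannelsChannelsResolveTameDevelopmentsRTrappedSetEndgame`) related the two base-point
notions of the K2R lines — `IsEscaping` (time separation from `ι X` tends to `∞`) and the sibling
`TameHull.IsFutureEscaping` (eventually leaves `J⁻(K)` for every compact `K`) — GRANTED the
missing causal-theory fact C6: *in a Cauchy development the time separation `d(ι x, q)` is bounded
uniformly in `x ∈ X` and `q ∈ K`, for every compact `K`*.  This file proves C6 and makes the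
bridge unconditional (self-contained over the two lines' `Defs` files and the Literature; it
does not import the S7 audit file).

Proof of C6 (O'Neill 1983, Ch. 14, Lemma 14.21 with Lemma 14.22 and Lemma 14.40; Beem–Ehrlich
1981, Lemma 3.5): a future causal segment from `ι x` to `q ∈ K` lies in the causal interval
`J⁺(ι X) ∩ J⁻(K)`; this set is COMPACT in a Cauchy development (§2: finitely many chronological
pasts `I⁻(kᵢ⁺)` cover `K`, so `J⁻(K) ⊆ ⋃ᵢ J⁻(kᵢ⁺)` and `J⁻(K) ∩ J⁺(ι X)` is a closed subset of the
finite union of the compact sets `J⁻(kᵢ⁺) ∩ J⁺(ι X)` of Hawking–Ellis, Prop. 6.6.6,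
`CauchyDevelopment.isCompact_causalPast_inter_causalFuture_range`); and a Cauchy development is
STRONGLY CAUSAL (`CauchyDevelopment.isStronglyCausal`), so the causal segments inside a compact set
have uniformly bounded length (`IsStronglyCausal.exists_arcLength_le_of_isCompact`), whence the
supremum `d(ι x, q)` of such lengths is bounded (§1, `lorentzDist_le_iff`).

* §1 general time-oriented Lorentzian manifolds: `d(p, q) ≤ B` as soon as the causal segments
  inside a set containing `J⁺(p) ∩ J⁻(q)` have length `≤ B`; under strong causality a compact
  set carries such a finite `B`; finitely many point pasts cover `J⁻(K)` for compact `K`.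
* §2 Cauchy developments (any dimension): `J⁻(K) ∩ J⁺(ι X)` is compact for compact `K`
  (`isCompact_causalPast_inter_causalFuture_range_of_isCompact`); the time separation is bounded
  on `J⁺(ι X) × K` (`exists_lorentzDist_le_of_isCompact`), in particular on `ι X × K`.
* §3 the line's objects (dimension `3 + 1`): registered sub-goal
  `stub_timeSeparationBoundedOnCompacts` (C6); an escaping sequence eventually leaves the causal
  past of every compact set, in particular every compact set (it tends to the cocompact filter);
  the bridge `IsEscaping ⇒ TameHull.IsFutureEscaping` for outer sequences, now unconditional
  (registered sub-goal `stub_isFutureEscapingOfIsEscaping`).  The converse bridge is false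
  (points of `ℝ⁴₁` marching to `i⁰` at time `1`; audit A2 of S7).

## References

* B. O'Neill, *Semi-Riemannian geometry with applications to relativity*, Academic Press 1983,
  Ch. 14, Def. 14.15, Lemma 14.14, Prop. 14.19, Lemma 14.21–14.22 (pp. 407–412), Lemma 14.40
  (p. 423), Ex. 14.4 (b) (p. 438). [ONeillSemiRiemannian1983]
* J. K. Beem, P. E. Ehrlich, *Global Lorentzian Geometry*, Marcel Dekker 1981, Lemma 3.5.
* S. W. Hawking, G. F. R. Ellis, *The large scale structure of space-time*, CUP 1973, §6.6,
  Prop. 6.6.6 (p. 211). [HawkingEllis1973CUP]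
-/

set_option linter.dupNamespace false

noncomputable section

namespace Summit.FinalStateConjecture.FinalStateConjecture.Theorems.TrappedSet

open Literature.Geometry.Lorentzian
open scoped Manifold ContDiff Topology ENNReal NNReal
open Filter Set Function TopologicalSpace

/-! ## §1 Time separation across sets in which causal segments have bounded length -/

section General

variable {E : Type*} [NormedAddCommGroup E] [NormedSpace ℝ E] {H : Type*} [TopologicalSpace H]
  {I : ModelWithCorners ℝ E H} {n : ℕ∞ω} {M : Type*} [TopologicalSpace M] [ChartedSpace H M]
  [IsManifold I ∞ M] {g : LorentzianMetric I n M} {τ : TimeOrientation g}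

/-- Every point of a future causal segment `γ : [a, b] → M` lies in the causal interval
`J(γ a, γ b) = J⁺(γ a) ∩ J⁻(γ b)` of its endpoints. O'Neill 1983, Ch. 14, p. 402 and Def. p. 409
(`J(p, q)`). [cite: ONeillSemiRiemannian1983, Ch. 14, p. 402] -/
theorem apply_mem_causalFuture_inter_causalPast {γ : ℝ → M} {a b t : ℝ}
    (hγ : g.IsFutureCausalCurveOn τ γ (Icc a b)) (ht : t ∈ Icc a b) :
    γ t ∈ g.causalFuture τ {γ a} ∩ g.causalPast τ {γ b} :=
  ⟨hγ.apply_mem_causalFuture_apply_left ht,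
    LorentzianMetric.mem_causalPast_singleton_iff.2 (hγ.apply_right_mem_causalFuture_apply ht)⟩

/-- **A length bound inside a set containing `J(p, q)` bounds `d(p, q)`**: if every future causal
segment contained in `C` has length `≤ B` and `J⁺(p) ∩ J⁻(q) ⊆ C`, then `d(p, q) ≤ B` — the time
separation is the supremum of the lengths of the future causal segments from `p` to `q`
(`lorentzDist_le_iff`), all of which run inside `J(p, q)`. O'Neill 1983, Ch. 14, Def. 14.15 and
proof of Prop. 14.19 ("A priori [`τ(p, q)`] could be `∞`, but the proof shows it is finite").
[cite: ONeillSemiRiemannian1983, Ch. 14, Def. 14.15 (p. 409)] -/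
theorem lorentzDist_le_of_causalFuture_inter_causalPast_subset {C : Set M} {B : ℝ≥0∞}
    (hB : ∀ (γ : ℝ → M) (a b : ℝ), a ≤ b → g.IsFutureCausalCurveOn τ γ (Icc a b) →
      (∀ t ∈ Icc a b, γ t ∈ C) → g.arcLength γ a b ≤ B)
    {p q : M} (hpq : g.causalFuture τ {p} ∩ g.causalPast τ {q} ⊆ C) :
    g.lorentzDist τ p q ≤ B :=
  LorentzianMetric.lorentzDist_le_iff.2 fun γ a b hab hγ ha hb ↦
    hB γ a b hab.le hγ fun t ht ↦ hpq (by
      rw [← ha, ← hb]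
      exact apply_mem_causalFuture_inter_causalPast hγ ht)

/-- **Under strong causality the time separation is bounded across every compact set**: on a
`Cⁿ` (`n ≥ 1`) strongly causal time-oriented Lorentzian manifold (finite-dimensional model without
boundary), for every compact `C` there is `B < ∞` with `d(p, q) ≤ B` whenever
`J⁺(p) ∩ J⁻(q) ⊆ C` (the causal segments inside `C` have uniformly bounded length,
`IsStronglyCausal.exists_arcLength_le_of_isCompact`). Beem–Ehrlich 1981, Lemma 3.5 (first
paragraph of the proof); O'Neill 1983, Ch. 14, proof of Lemma 14.14 and of Prop. 14.19.
[cite: ONeillSemiRiemannian1983, Ch. 14, Lemma 14.14 (proof) and Prop. 14.19] -/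
theorem exists_lorentzDist_le_of_isStronglyCausal [I.Boundaryless] [FiniteDimensional ℝ E]
    (hn : 1 ≤ n) (hsc : g.IsStronglyCausal τ) {C : Set M} (hC : IsCompact C) :
    ∃ B : ℝ≥0∞, B < ⊤ ∧ ∀ p q : M, g.causalFuture τ {p} ∩ g.causalPast τ {q} ⊆ C →
      g.lorentzDist τ p q ≤ B := by
  obtain ⟨B, hB, h⟩ :=
    LorentzianMetric.IsStronglyCausal.exists_arcLength_le_of_isCompact τ hn hsc hC
  exact ⟨B, hB, fun p q hpq ↦ lorentzDist_le_of_causalFuture_inter_causalPast_subset h hpq⟩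

/-- **Finitely many point pasts cover the causal past of a compact set**: on a manifold without
boundary (complete model) with a `C²` time-oriented metric, for compact `K` there are finitely
many points `kᵢ⁺` with `J⁻(K) ⊆ ⋃ᵢ J⁻(kᵢ⁺)`. Every `k` lies in the open set `I⁻(k⁺)` of a point
`k⁺ ≫ k` on the integral curve of the orienting field (`exists_mem_nhds_mem_chronologicalFuture`,
time-reversed); finitely many `I⁻(kᵢ⁺)` cover `K`, and `J⁻(I⁻(kᵢ⁺)) ⊆ J⁻(J⁻(kᵢ⁺)) = J⁻(kᵢ⁺)`.
The time dual of the covering step of `IsGloballyHyperbolic.isClosed_causalFuture_of_isCompact`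
(O'Neill 1983, Ch. 14, Ex. 14.4 (b)). [cite: ONeillSemiRiemannian1983, Ch. 14, Lemma 14.22 and Ex. 14.4 (b) (pp. 412, 438)] -/
theorem exists_finset_causalPast_subset_biUnion [BoundarylessManifold I M] [CompleteSpace E]
    (hn : 2 ≤ n) {K : Set M} (hK : IsCompact K) :
    ∃ t : Finset M, g.causalPast τ K ⊆ ⋃ k ∈ t, g.causalPast τ {k} := by
  classical
  have hn1 : (1 : ℕ∞ω) ≤ n := le_trans one_le_two hn
  have hchoice : ∀ k : M, ∃ k' : M, k ∈ g.chronologicalPast τ {k'} := fun k ↦ by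
    obtain ⟨k', -, hk'⟩ := LorentzianMetric.exists_mem_nhds_mem_chronologicalFuture
      (g := g) (τ := τ.reverse) hn1 (univ_mem : (univ : Set M) ∈ 𝓝 k)
    exact ⟨k', hk'⟩
  choose kp hkp using hchoice
  obtain ⟨t, -, ht⟩ := hK.elim_nhds_subcover (fun k ↦ g.chronologicalPast τ {kp k})
    fun k _ ↦ (LorentzianMetric.isOpen_chronologicalPast_of_boundaryless g τ _).mem_nhds (hkp k)
  refine ⟨t.image kp, fun y hy ↦ ?_⟩
  rw [LorentzianMetric.causalPast, LorentzianMetric.causalFuture_eq_biUnion] at hy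
  obtain ⟨k, hkK, hyk⟩ := mem_iUnion₂.1 hy
  obtain ⟨i, hit, hki⟩ := mem_iUnion₂.1 (ht hkK)
  refine mem_iUnion₂.2 ⟨kp i, Finset.mem_image_of_mem kp hit, ?_⟩
  have hyi : y ∈ g.causalFuture τ.reverse (g.causalFuture τ.reverse {kp i}) :=
    LorentzianMetric.causalFuture_mono (singleton_subset_iff.2
      (LorentzianMetric.chronologicalFuture_subset_causalFuture g τ.reverse _ hki)) hyk
  rwa [LorentzianMetric.causalFuture_causalFuture_eq hn] at hyi

end General

/-! ## §2 Cauchy developments: compact causal intervals above `ι X`, bounded time separation -/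

section Development

universe u

variable {d : ℕ} {X : Type u} [TopologicalSpace X] [ChartedSpace (EuclideanSpace ℝ (Fin d)) X]
  [IsManifold (𝓡 d) ∞ X] [ConnectedSpace X] {D : InitialDataSet (𝓡 d) X}

/-- `1 ≤ ∞` in `ℕ∞ω` (regularity side condition). [folklore] -/
private lemma one_le_infty : (1 : ℕ∞ω) ≤ (∞ : ℕ∞ω) := WithTop.coe_le_coe.mpr le_top

/-- `2 ≤ ∞` in `ℕ∞ω` (regularity side condition). [folklore] -/
private lemma two_le_infty : (2 : ℕ∞ω) ≤ (∞ : ℕ∞ω) := WithTop.coe_le_coe.mpr le_top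

/-- **`J⁻(K) ∩ J⁺(ι X)` is compact in a Cauchy development, for every compact `K`** (Hawking–Ellis
1973, Prop. 6.6.6 for compact sets in place of points; O'Neill 1983, Ch. 14, Lemma 14.40 with
Lemma 14.22): it is closed (`J⁻(K)` is closed for compact `K` in the globally hyperbolic
development, `J⁺(ι X) = M ∖ I⁻(ι X)` is closed) and contained in the finite union of the compact
sets `J⁻(kᵢ⁺) ∩ J⁺(ι X)` (`exists_finset_causalPast_subset_biUnion`,
`CauchyDevelopment.isCompact_causalPast_inter_causalFuture_range`).
[cite: HawkingEllis1973CUP, §6.6, Prop. 6.6.6 (p. 211)] -/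
theorem isCompact_causalPast_inter_causalFuture_range_of_isCompact (𝒟 : CauchyDevelopment D)
    {K : Set 𝒟.carrier} (hK : IsCompact K) :
    IsCompact (𝒟.metric.causalPast 𝒟.timeOrientation K ∩
      𝒟.metric.causalFuture 𝒟.timeOrientation (range 𝒟.embed)) := by
  obtain ⟨t, ht⟩ :=
    exists_finset_causalPast_subset_biUnion (τ := 𝒟.timeOrientation) two_le_infty hK
  have hC : IsCompact (⋃ k ∈ t, 𝒟.metric.causalPast 𝒟.timeOrientation {k} ∩
      𝒟.metric.causalFuture 𝒟.timeOrientation (range 𝒟.embed)) :=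
    t.isCompact_biUnion fun k _ ↦ 𝒟.isCompact_causalPast_inter_causalFuture_range k
  refine hC.of_isClosed_subset ?_ ?_
  · exact (𝒟.isGloballyHyperbolic.reverse.isClosed_causalFuture_of_isCompact two_le_infty hK).inter
      (𝒟.isCauchyHypersurface.isClosed_causalFuture_set two_le_infty)
  · rintro y ⟨hyK, hyS⟩
    obtain ⟨k, hk, hyk⟩ := mem_iUnion₂.1 (ht hyK)
    exact mem_iUnion₂.2 ⟨k, hk, hyk, hyS⟩

/-- **The time separation of a Cauchy development is bounded on `J⁺(ι X) × K` for compact `K`**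
(O'Neill 1983, Ch. 14, Lemma 14.21: on a globally hyperbolic set the time separation is finite
[and continuous]; Beem–Ehrlich 1981, Lemma 3.5): there is `B < ∞` with `d(p, q) ≤ B` for all
`p ∈ J⁺(ι X)`, `q ∈ K`.  The causal interval `J⁺(p) ∩ J⁻(q)` lies in the compact set
`J⁻(K) ∩ J⁺(ι X)` (`J⁺ J⁺ = J⁺`), inside which causal segments have bounded length by strong
causality of the development (`exists_lorentzDist_le_of_isStronglyCausal`,
`CauchyDevelopment.isStronglyCausal`). [cite: ONeillSemiRiemannian1983, Ch. 14, Lemma 14.21] -/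
theorem exists_lorentzDist_le_of_isCompact (𝒟 : CauchyDevelopment D) {K : Set 𝒟.carrier}
    (hK : IsCompact K) :
    ∃ B : ℝ≥0∞, B < ⊤ ∧ ∀ p ∈ 𝒟.metric.causalFuture 𝒟.timeOrientation (range 𝒟.embed),
      ∀ q ∈ K, 𝒟.toSpacetime.lorentzDist p q ≤ B := by
  obtain ⟨B, hB, h⟩ := exists_lorentzDist_le_of_isStronglyCausal (τ := 𝒟.timeOrientation)
    one_le_infty 𝒟.isStronglyCausal (isCompact_causalPast_inter_causalFuture_range_of_isCompact 𝒟 hK)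
  refine ⟨B, hB, fun p hp q hq ↦ h p q ?_⟩
  rintro y ⟨hyp, hyq⟩
  refine ⟨LorentzianMetric.causalFuture_mono (τ := 𝒟.timeOrientation.reverse)
    (singleton_subset_iff.2 hq) hyq, ?_⟩
  have hy : y ∈ 𝒟.metric.causalFuture 𝒟.timeOrientation
      (𝒟.metric.causalFuture 𝒟.timeOrientation (range 𝒟.embed)) :=
    LorentzianMetric.causalFuture_mono (singleton_subset_iff.2 hp) hyp
  rwa [LorentzianMetric.causalFuture_causalFuture_eq two_le_infty] at hy

/-- **The time separation from the Cauchy hypersurface is bounded on compact sets**: for compact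
`K` there is `B < ∞` with `d(ι x, q) ≤ B` for all `x ∈ X`, `q ∈ K` (`ι x ∈ ι X ⊆ J⁺(ι X)` in
`exists_lorentzDist_le_of_isCompact`). O'Neill 1983, Ch. 14, Lemma 14.21 with Lemma 14.40.
[cite: ONeillSemiRiemannian1983, Ch. 14, Lemma 14.21] -/
theorem exists_lorentzDist_embed_le_of_isCompact (𝒟 : CauchyDevelopment D) {K : Set 𝒟.carrier}
    (hK : IsCompact K) :
    ∃ B : ℝ≥0∞, B < ⊤ ∧ ∀ x : X, ∀ q ∈ K, 𝒟.toSpacetime.lorentzDist (𝒟.embed x) q ≤ B := by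
  obtain ⟨B, hB, h⟩ := exists_lorentzDist_le_of_isCompact 𝒟 hK
  exact ⟨B, hB, fun x q hq ↦ h _ (LorentzianMetric.subset_causalFuture _ _ _ ⟨x, rfl⟩) q hq⟩

/-- Real-valued form of `exists_lorentzDist_embed_le_of_isCompact` (the shape of the hypothesis
`hfin` of the conditional bridge `isFutureEscaping_of_isEscaping` of the S7 audit file
`PhotonSphereChannelsChannelsResolveTameDevelopmentsRTrappedSetEndgame`): for compact `K` there
is `T : ℝ` with `d(ι x, q) ≤ T` for all `x ∈ X`, `q ∈ K`. O'Neill 1983, Ch. 14, Lemma 14.21.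
[cite: ONeillSemiRiemannian1983, Ch. 14, Lemma 14.21] -/
theorem exists_lorentzDist_embed_le_ofReal_of_isCompact (𝒟 : CauchyDevelopment D)
    {K : Set 𝒟.carrier} (hK : IsCompact K) :
    ∃ T : ℝ, ∀ x : X, ∀ q ∈ K, 𝒟.toSpacetime.lorentzDist (𝒟.embed x) q ≤ ENNReal.ofReal T := by
  obtain ⟨B, hB, h⟩ := exists_lorentzDist_embed_le_of_isCompact 𝒟 hK
  exact ⟨B.toReal, fun x q hq ↦ (h x q hq).trans (ENNReal.ofReal_toReal hB.ne).ge⟩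

/-- **The time separation from `ι X` is bounded on the whole causal past `J⁻(K)` of a compact
set**: there is `B < ∞` with `d(ι x, y) ≤ B` for all `x ∈ X`, `y ∈ J⁻(K)`.  Split
`J⁻(K) = (J⁻(K) ∩ J⁺(ι X)) ∪ (J⁻(K) ∖ J⁺(ι X))`: the first part is compact
(`isCompact_causalPast_inter_causalFuture_range_of_isCompact`), and on the second `d(ι x, y) = 0`
since `y ∉ J⁺(ι x)` (`lorentzDist_eq_zero_of_not_mem_causalFuture`). O'Neill 1983, Ch. 14,
Def. 14.15 and Lemma 14.21. [cite: ONeillSemiRiemannian1983, Ch. 14, Lemma 14.21] -/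
theorem exists_lorentzDist_embed_le_of_mem_causalPast (𝒟 : CauchyDevelopment D)
    {K : Set 𝒟.carrier} (hK : IsCompact K) :
    ∃ B : ℝ≥0∞, B < ⊤ ∧ ∀ x : X, ∀ y ∈ 𝒟.metric.causalPast 𝒟.timeOrientation K,
      𝒟.toSpacetime.lorentzDist (𝒟.embed x) y ≤ B := by
  obtain ⟨B, hB, h⟩ := exists_lorentzDist_embed_le_of_isCompact 𝒟
    (isCompact_causalPast_inter_causalFuture_range_of_isCompact 𝒟 hK)
  refine ⟨B, hB, fun x y hy ↦ ?_⟩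
  by_cases hyS : y ∈ 𝒟.metric.causalFuture 𝒟.timeOrientation (range 𝒟.embed)
  · exact h x y ⟨hy, hyS⟩
  · rw [Spacetime.lorentzDist_eq, LorentzianMetric.lorentzDist_eq_zero_of_not_mem_causalFuture
      fun hyx ↦ hyS (LorentzianMetric.causalFuture_mono (T := range 𝒟.embed)
        (singleton_subset_iff.2 (mem_range_self x)) hyx)]
    exact zero_le

end Development

/-! ## §3 The line's objects: C6, escaping sequences leave compact sets, the unconditional bridge -/

section Line

variable {X : Type} [TopologicalSpace X] [ChartedSpace Literature.Geometry.Lorentzian.E3 X]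
  [IsManifold (modelWithCornersSelf ℝ Literature.Geometry.Lorentzian.E3) ((⊤ : ℕ∞) : WithTop ℕ∞) X]
  [ConnectedSpace X]
  {D : Literature.Geometry.Lorentzian.InitialDataSet (modelWithCornersSelf ℝ Literature.Geometry.Lorentzian.E3) X}

/-- **An escaping sequence eventually leaves the causal past of every compact set**: the time
separation from `ι X` is bounded by some `B < ∞` on `J⁻(K)`
(`exists_lorentzDist_embed_le_of_mem_causalPast`), while along an escaping sequence it
eventually exceeds `B + 1` (the S7 audit's `IsEscaping.eventually_not_mem_causalPast`, there
conditional on the bound, made unconditional by C6). [cite: ONeillSemiRiemannian1983, Ch. 14, Lemma 14.21] -/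
theorem IsEscaping.eventually_not_mem_causalPast_of_isCompact {𝒟 : CauchyDevelopment D}
    {p : ℕ → 𝒟.carrier} (h : IsEscaping 𝒟 p) {K : Set 𝒟.carrier} (hK : IsCompact K) :
    ∀ᶠ n in atTop, p n ∉ 𝒟.metric.causalPast 𝒟.timeOrientation K := by
  obtain ⟨B, hB, hle⟩ := exists_lorentzDist_embed_le_of_mem_causalPast 𝒟 hK
  filter_upwards [h (B.toReal + 1)] with n hn hpn
  obtain ⟨x, hx⟩ := hn
  have h1 : ENNReal.ofReal (B.toReal + 1) ≤ ENNReal.ofReal B.toReal :=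
    (hx.trans (hle x _ hpn)).trans (ENNReal.ofReal_toReal hB.ne).ge
  rw [ENNReal.ofReal_le_ofReal_iff ENNReal.toReal_nonneg] at h1
  linarith

/-- **An escaping sequence eventually leaves every compact set** (`K ⊆ J⁻(K)`). [folklore] -/
theorem IsEscaping.eventually_not_mem_of_isCompact {𝒟 : CauchyDevelopment D}
    {p : ℕ → 𝒟.carrier} (h : IsEscaping 𝒟 p) {K : Set 𝒟.carrier} (hK : IsCompact K) :
    ∀ᶠ n in atTop, p n ∉ K :=
  (h.eventually_not_mem_causalPast_of_isCompact hK).mono fun _ hn hK' ↦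
    hn (LorentzianMetric.subset_causalPast _ _ K hK')

/-- **An escaping sequence tends to infinity in the development** (it converges to the cocompact
filter: it eventually leaves every compact set). [folklore] -/
theorem IsEscaping.tendsto_cocompact {𝒟 : CauchyDevelopment D} {p : ℕ → 𝒟.carrier}
    (h : IsEscaping 𝒟 p) : Tendsto p atTop (cocompact 𝒟.carrier) := by
  rw [Filter.hasBasis_cocompact.tendsto_right_iff]
  exact fun K hK ↦ h.eventually_not_mem_of_isCompact hK

/-- **C6, registered sub-goal `stub_timeSeparationBoundedOnCompacts` of `stub_tameEndgame` (S7):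
in a Cauchy development the time separation from the Cauchy hypersurface `ι X` is bounded on
every compact set** — for compact `K` there is `B < ∞` with `d(ι x, q) ≤ B` for all `x ∈ X`,
`q ∈ K` (`exists_lorentzDist_embed_le_of_isCompact`: compactness of `J⁻(K) ∩ J⁺(ι X)` and strong
causality of the development). O'Neill 1983, Ch. 14, Lemma 14.21 (finiteness of the time
separation on globally hyperbolic sets) with Lemma 14.40. [cite: ONeillSemiRiemannian1983, Ch. 14, Lemma 14.21] -/
theorem stub_timeSeparationBoundedOnCompacts : ∀ (X : Type) [TopologicalSpace X] [ChartedSpace Literature.Geometry.Lorentzian.E3 X] [IsManifold (modelWithCornersSelf ℝ Literature.Geometry.Lorentzian.E3) ((⊤ : ℕ∞) : WithTop ℕ∞) X] [ConnectedSpace X] (D : Literature.Geometry.Lorentzian.InitialDataSet (modelWithCornersSelf ℝ Literature.Geometry.Lorentzian.E3) X) (𝒟 : Literature.Geometry.Lorentzian.CauchyDevelopment D) (K : Set 𝒟.carrier), IsCompact K → ∃ B : ENNReal, B < ⊤ ∧ ∀ (x : X), ∀ q ∈ K, 𝒟.toSpacetime.lorentzDist (𝒟.embed x) q ≤ B :=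 by
  intro X _ _ _ _ D 𝒟 K hK
  exact exists_lorentzDist_embed_le_of_isCompact 𝒟 hK

/-- **The escape-notion bridge, unconditional**: an escaping sequence (`IsEscaping`: time
separation from `ι X` tends to `∞`) of outer points of a vacuum Cauchy development is
future-escaping in the sense of the sibling line `tame-hull-exact-rigidity-only`
(`TameHull.IsFutureEscaping`: eventually leaves `J⁻(K)` for every compact `K`; the two lines'
`outerRegion`s agree definitionally) — the conditional bridge `isFutureEscaping_of_isEscaping`
of the S7 audit with its boundedness hypothesis discharged by C6
(`IsEscaping.eventually_not_mem_causalPast_of_isCompact`).  The converse fails (points of `ℝ⁴₁`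
marching to spatial infinity at time `1`). [cite: ONeillSemiRiemannian1983, Ch. 14, Lemma 14.21] -/
theorem IsEscaping.isFutureEscaping {X : Type} [TopologicalSpace X]
    [ChartedSpace Literature.Geometry.Lorentzian.E3 X]
    [IsManifold (modelWithCornersSelf ℝ Literature.Geometry.Lorentzian.E3) ((⊤ : ℕ∞) : WithTop ℕ∞) X]
    [T2Space X] [SecondCountableTopology X] [ConnectedSpace X]
    {D : Literature.Geometry.Lorentzian.InitialDataSet (modelWithCornersSelf ℝ Literature.Geometry.Lorentzian.E3) X}
    {𝒟 : VacuumCauchyDevelopment D} [𝒟.metric.HasLeviCivita] {p : ℕ → 𝒟.carrier}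
    (h : IsEscaping 𝒟.toCauchyDevelopment p) (hout : ∀ n, p n ∈ outerRegion 𝒟.toCauchyDevelopment) :
    TameHull.IsFutureEscaping 𝒟 p :=
  ⟨hout, fun _ hK ↦ h.eventually_not_mem_causalPast_of_isCompact hK⟩

/-- **Registered sub-goal `stub_isFutureEscapingOfIsEscaping` of `stub_tameEndgame` (S7), audit
A2 made unconditional**: `IsEscaping ⇒ TameHull.IsFutureEscaping` for sequences of outer points
(`IsEscaping.isFutureEscaping`). [cite: ONeillSemiRiemannian1983, Ch. 14, Lemma 14.21] -/
theorem stub_isFutureEscapingOfIsEscaping : ∀ (X : Type) [TopologicalSpace X] [ChartedSpace Literature.Geometry.Lorentzian.E3 X] [IsManifold (modelWithCornersSelf ℝ Literature.Geometry.Lorentzian.E3) ((⊤ : ℕ∞) : WithTop ℕ∞) X] [T2Space X] [SecondCountableTopology X] [ConnectedSpace X] (D : Literature.Geometry.Lorentzian.InitialDataSet (modelWithCornersSelf ℝ Literature.Geometry.Lorentzian.E3) X) (𝒟 : Literature.Geometry.Lorentzian.VacuumCauchyDevelopment D) [𝒟.metric.HasLeviCivita] (p : ℕ → 𝒟.carrier),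 IsEscaping 𝒟.toCauchyDevelopment p → (∀ n, p n ∈ outerRegion 𝒟.toCauchyDevelopment) → Summit.FinalStateConjecture.FinalStateConjecture.Theorems.TameHull.IsFutureEscaping 𝒟 p := by
  intro X _ _ _ _ _ _ D 𝒟 _ p h hout
  exact h.isFutureEscaping hout

end Line

end Summit.FinalStateConjecture.FinalStateConjecture.Theorems.TrappedSet

end
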